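import Summits.NavierStokesRegularity.FunctionalMining.TopEigTransport
import Summits.NavierStokesRegularity.FunctionalMining.TopEigHeatDanskin
import Literature.Analysis.FunctionSpaces.TorusRademacher
import Literature.Analysis.FunctionSpaces.TorusHolderBridge
import Literature.Analysis.FunctionSpaces.TorusInverseLaplacianCalculus
import HarnessLib

/-!
# FunctionalMining — K1-Q6 support: the AMPLITUDE FLOOR of the `Φ_q` heat price (LEMMA AF ≡ LEMMA G), KERNEL PROOF

Search for candidate a priori estimates; no regularity claim. Cell `pub-nsfunc`, census-2 seat
(gen 42, 2026-08-23), STAGED for the prove seat (`pub-nsfunc-census-2/lean/af/TopEigAmplitudeFloor.lean`).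

STATEMENT (the dict seat's typed node `TopEigAmplitudeFloor q`, staging `TopEigAmplitudeFloor.STAGING.lean`
1d2727c7e29f5956, copied verbatim in §0): on `T³`, for every smooth divergence-free `v` and `λ := λ₁ ∘ S_v`,
`q(q−1) ∫ λ^{q−2} Σᵢ (∂ᵢλ)² ≤ heatDissipation Φ_q v`.  PROVED HERE for every real `q ≥ 2`
(`topEigAmplitudeFloor_of_two_le`).

PEN SOURCES (three hands, one inequality): nogo g31 `K1Q6-RATE-NOTE.md` 6468c8ce3951537d §2 LEMMA AF
(first order: `λ₁(p_τ∗S) ≤ p_τ∗λ₁` + scalar Jensen); census-2 g42 `MIXRATE-S-B.md` b43f8bbf080c1677 §1 LEMMA G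
(second order: semiconvexity/Alexandrov + Danskin); dict g34 `K1Q6-S-CHECK-D` / `MIXRATE-S-CHECK-D` (reads).
THE PROOF FORMALISED is the third one, `MIXRATE-S-B.ADD2.md` (i) (census-2 g42): SECOND DIFFERENCE QUOTIENTS.
* §1 a uniform Taylor estimate along a direction for smooth torus functions:
  `‖G(x+tu) + G(x−tu) − 2G(x) − t²∂ᵤ∂ᵤG(x)‖ ≤ C|t|³` (three applications of the mean value inequality);
* §2 `Δ(S_v) = S_(Δv)` (Schwarz, `Torus.partialDeriv_laplacian_comm`);
* §3 discrete integration by parts on `T^d` (translation invariance of Haar measure);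
* §4 the POINTWISE inequality at EVERY `x`: `Σᵢ [λ(x+teᵢ) + λ(x−teᵢ) − 2λ(x)] ≥ t² μ(S(x); S_(Δv)(x)) − C|t|³`
  (`λ ≥ eᵀS(·)e` with equality at `x` for `e` a top unit vector of `S(x)`; `TopEig.dirTopEig_le`);
* §5 Rademacher (`Torus.ae_differentiableAt_liftAt`) + dominated convergence for the products of slopes of
  `λ` and `qλ^{q−1}` (constant dominating function from the line-Lipschitz bounds);
* §6 assembly: integrate §4 against `φ := qλ^{q−1} ≥ 0`, §3 per axis, divide by `t²`, `t → 0⁺` by §5, and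
  the tree's Danskin identity `heatDissipation_topEigMoment_eq_integral` (`heatDissipation Φ_q v = −∫ φ μ`).
No heat kernel, no second-order differentiability of `λ`, no Fatou. Main theorem:
`topEigAmplitudeFloor_of_two_le (hq : 2 ≤ q) : TopEigAmplitudeFloor q` (axioms: propext,
Classical.choice, Quot.sound). [ours]
-/

noncomputable section

/-! FILING NOTE (prove seat g25): census-2 C2-LKB-5 v3 `TopEigAmplitudeFloor.lean` dac5012ad55a3252 (679 l.)
is filed SPLIT for the 400-line lint, declaration blocks byte-identical: THIS FILE = §0 (the node) + §§1–4;
`TopEigAmplitudeFloorHolds.lean` = §§5–6 (incl. the main theorem `topEigAmplitudeFloor_of_two_le`).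
Search for candidate a priori estimates; no regularity claim. -/

open MeasureTheory Set Filter Topology

namespace Summit.NavierStokesRegularity.FunctionalMining

open Literature.Analysis.FunctionSpaces Literature.Analysis.FluidPDE

variable {d : Type*} [Fintype d] [DecidableEq d]

/-! ## §0 The typed node (dict seat, verbatim) -/

/-- **LEMMA AF, typed (`TopEigAmplitudeFloor q`).** On `T³` (`Fintype.card d = 3` inside the `Prop`,
the cell's convention), for every smooth divergence-free `v`:
`q(q−1) ∫ λ₁(S_v)^{q−2} Σᵢ (∂ᵢ λ₁(S_v))² ≤ heatDissipation Φ_q v`. Intended for real `q ≥ 2`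
(at `q = 2` the weight `λ^{0} = 1`, `Real.rpow` convention `0^0 = 1`, matching the pen statement
`T_Φ ≥ 2∫|∇λ|²`). [ours; typed by the dict seat g34 (staging 1d2727c7e29f5956); proved below for `q ≥ 2`] -/
def TopEigAmplitudeFloor (q : ℝ) : Prop :=
  Fintype.card d = 3 →
    ∀ v : UnitAddTorus d → EuclideanSpace ℝ d, Torus.IsSmooth v → Torus.IsDivFree v →
      q * (q - 1) * ∫ x, torusStrainTopEig v x ^ (q - 2) *
          ∑ i, (Torus.partialDeriv i (fun y => torusStrainTopEig v y) x) ^ 2 ≤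
        heatDissipation (torusTopEigMoment q) v

/-- Under `TopEigAmplitudeFloor q`, any lower bound `A ≤ q(q−1)∫λ^{q−2}|∇λ|²` is a lower bound on
`heatDissipation Φ_q v`. [ours, bookkeeping; dict seat] -/
theorem TopEigAmplitudeFloor.le_heatDissipation {q : ℝ} (h : TopEigAmplitudeFloor (d := d) q)
    (hd : Fintype.card d = 3) {v : UnitAddTorus d → EuclideanSpace ℝ d} (hv : Torus.IsSmooth v)
    (hdv : Torus.IsDivFree v) {A : ℝ}
    (hA : A ≤ q * (q - 1) * ∫ x, torusStrainTopEig v x ^ (q - 2) *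
          ∑ i, (Torus.partialDeriv i (fun y => torusStrainTopEig v y) x) ^ 2) :
    A ≤ heatDissipation (torusTopEigMoment q) v :=
  hA.trans (h hd v hv hdv)

/-- The integrand of the amplitude floor is pointwise non-negative wherever `λ₁ ≥ 0`.
[ours, bookkeeping; dict seat] -/
theorem TopEigAmplitudeFloor.integrand_nonneg (q : ℝ) (v : UnitAddTorus d → EuclideanSpace ℝ d)
    {x : UnitAddTorus d} (hdv : 0 ≤ torusStrainTopEig v x) :
    0 ≤ torusStrainTopEig v x ^ (q - 2) *
        ∑ i, (Torus.partialDeriv i (fun y => torusStrainTopEig v y) x) ^ 2 :=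
  mul_nonneg (Real.rpow_nonneg hdv _) (Finset.sum_nonneg fun _ _ => sq_nonneg _)

namespace TopEig

open StrainL4

/-! ## §1 Second differences of smooth torus functions along a direction -/

section SecondDiff

variable {F : Type*} [NormedAddCommGroup F] [NormedSpace ℝ F]

omit [DecidableEq d] in
/-- **Uniform second-order Taylor estimate along a direction.** For smooth `G : T^d → F` and a
direction `u` there is `C` with
`‖G(x + tu) + G(x − tu) − 2G(x) − t² ∂ᵤ∂ᵤG(x)‖ ≤ C|t|³` for all `x, t`
(three mean value inequalities; `C = 2 sup ‖∂ᵤ∂ᵤ∂ᵤG‖`). [ours] -/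
theorem exists_norm_secondDiff_sub_le (G : UnitAddTorus d → F) (hG : Torus.IsSmooth G)
    (u : EuclideanSpace ℝ d) : ∃ C, ∀ (x : UnitAddTorus d) (t : ℝ),
    ‖G (x + Torus.proj (t • u)) + G (x + Torus.proj ((-t) • u)) - (2 : ℝ) • G x -
        t ^ 2 • Torus.lineDeriv (fun y => Torus.lineDeriv G y u) x u‖ ≤ C * |t| ^ 3 := by
  set G₁ : UnitAddTorus d → F := fun y => Torus.lineDeriv G y u with hG₁_def
  set G₂ : UnitAddTorus d → F := fun y => Torus.lineDeriv G₁ y u with hG₂_def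
  set G₃ : UnitAddTorus d → F := fun y => Torus.lineDeriv G₂ y u with hG₃_def
  have hG₁ : Torus.IsSmooth G₁ := hG.lineDeriv u
  have hG₂ : Torus.IsSmooth G₂ := hG₁.lineDeriv u
  have hG₃ : Torus.IsSmooth G₃ := hG₂.lineDeriv u
  obtain ⟨C₃, hC₃⟩ := exists_forall_norm_le hG₃.continuous
  have hC₃0 : 0 ≤ C₃ := (norm_nonneg _).trans (hC₃ 0)
  refine ⟨2 * C₃, fun x t => ?_⟩
  -- Claim A: `G₂` is `C₃`-Lipschitz along `u`-lines
  have hA : ∀ s : ℝ, ‖G₂ (x + Torus.proj (s • u)) - G₂ x‖ ≤ C₃ * |s| := fun s =>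
    norm_translate_sub_le (hG₂.isContDiff (by simp)) hC₃ x s
  -- Claim B: first-order remainder of `G₁`
  have hB : ∀ S : ℝ, ‖G₁ (x + Torus.proj (S • u)) - G₁ x - S • G₂ x‖ ≤ C₃ * |S| * |S| := by
    intro S
    have hder : ∀ s ∈ uIcc (0 : ℝ) S, HasDerivWithinAt
        (fun s : ℝ => G₁ (x + Torus.proj (s • u)) - G₁ x - s • G₂ x)
        (G₂ (x + Torus.proj (s • u)) - G₂ x) (uIcc (0 : ℝ) S) s := by
      intro s _
      have h1 := Torus.hasDerivAt_comp_add_proj_smul (hG₁.isContDiff (by simp)) x u s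
      have h2 : HasDerivAt (fun s : ℝ => s • G₂ x) ((1 : ℝ) • G₂ x) s :=
        (hasDerivAt_id s).smul_const (G₂ x)
      have h := (h1.sub_const (G₁ x)).sub h2
      rw [one_smul] at h
      exact h.hasDerivWithinAt
    have hbd : ∀ s ∈ uIcc (0 : ℝ) S, ‖G₂ (x + Torus.proj (s • u)) - G₂ x‖ ≤ C₃ * |S| := by
      intro s hs
      refine (hA s).trans (mul_le_mul_of_nonneg_left ?_ hC₃0)
      have := Set.abs_sub_left_of_mem_uIcc hs
      simpa using this
    have h := (convex_uIcc (0 : ℝ) S).norm_image_sub_le_of_norm_hasDerivWithin_le hder hbd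
      (left_mem_uIcc) (right_mem_uIcc)
    simp only [zero_smul, Torus.proj_zero, add_zero, sub_self, sub_zero, Real.norm_eq_abs] at h
    simpa [mul_comm, mul_assoc, mul_left_comm] using h
  -- Claim C: second-order remainder of `G`
  have hC : ∀ S : ℝ, ‖G (x + Torus.proj (S • u)) - G x - S • G₁ x - (S ^ 2 / 2) • G₂ x‖ ≤
      C₃ * |S| * |S| * |S| := by
    intro S
    have hder : ∀ s ∈ uIcc (0 : ℝ) S, HasDerivWithinAt
        (fun s : ℝ => G (x + Torus.proj (s • u)) - G x - s • G₁ x - (s ^ 2 / 2) • G₂ x)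
        (G₁ (x + Torus.proj (s • u)) - G₁ x - s • G₂ x) (uIcc (0 : ℝ) S) s := by
      intro s _
      have h1 := Torus.hasDerivAt_comp_add_proj_smul (hG.isContDiff (by simp)) x u s
      have h2 : HasDerivAt (fun s : ℝ => s • G₁ x) ((1 : ℝ) • G₁ x) s :=
        (hasDerivAt_id s).smul_const (G₁ x)
      have h3 : HasDerivAt (fun s : ℝ => (s ^ 2 / 2) • G₂ x) (s • G₂ x) s := by
        have h := ((hasDerivAt_pow 2 s).div_const (2 : ℝ)).smul_const (G₂ x)
        refine h.congr_deriv ?_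
        congr 1
        push_cast
        ring
      have h := ((h1.sub_const (G x)).sub h2).sub h3
      rw [one_smul] at h
      exact h.hasDerivWithinAt
    have hbd : ∀ s ∈ uIcc (0 : ℝ) S, ‖G₁ (x + Torus.proj (s • u)) - G₁ x - s • G₂ x‖ ≤
        C₃ * |S| * |S| := by
      intro s hs
      have hs' : |s| ≤ |S| := by
        have := Set.abs_sub_left_of_mem_uIcc hs
        simpa using this
      have hss : C₃ * |s| * |s| ≤ C₃ * |S| * |S| := by
        have := mul_le_mul hs' hs' (abs_nonneg s) (abs_nonneg S)
        nlinarith [abs_nonneg s, abs_nonneg S]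
      exact (hB s).trans hss
    have h := (convex_uIcc (0 : ℝ) S).norm_image_sub_le_of_norm_hasDerivWithin_le hder hbd
      (left_mem_uIcc) (right_mem_uIcc)
    simp only [zero_smul, Torus.proj_zero, add_zero, sub_self, sub_zero, Real.norm_eq_abs,
      ne_eq, OfNat.ofNat_ne_zero, not_false_eq_true, zero_pow, zero_div] at h
    simpa [mul_comm, mul_assoc, mul_left_comm] using h
  -- the second difference is `r₀(t) + r₀(−t)`
  have hsplit : G (x + Torus.proj (t • u)) + G (x + Torus.proj ((-t) • u)) - (2 : ℝ) • G x -
      t ^ 2 • Torus.lineDeriv (fun y => Torus.lineDeriv G y u) x u =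
      (G (x + Torus.proj (t • u)) - G x - t • G₁ x - (t ^ 2 / 2) • G₂ x) +
      (G (x + Torus.proj ((-t) • u)) - G x - (-t) • G₁ x - ((-t) ^ 2 / 2) • G₂ x) := by
    have e2 : Torus.lineDeriv (fun y => Torus.lineDeriv G y u) x u = G₂ x := rfl
    have e3 : t ^ 2 • G₂ x = (t ^ 2 / 2) • G₂ x + ((-t) ^ 2 / 2) • G₂ x := by
      rw [← add_smul]; congr 1; ring
    rw [e2, e3]
    simp only [neg_smul, two_smul]
    abel
  rw [hsplit]
  refine (norm_add_le _ _).trans ?_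
  have h1 := hC t
  have h2 := hC (-t)
  rw [abs_neg] at h2
  have habs : |t| ^ 3 = |t| * |t| * |t| := by ring
  rw [habs]
  linarith

end SecondDiff

/-! ## §2 The Laplacian commutes with the strain map -/

/-- **`Δ(S_v) = S_(Δv)`** pointwise, for smooth `v` (Schwarz: `∂ₖΔ = Δ∂ₖ`, and the strain entries are
fixed linear combinations of first derivatives). [ours] -/
theorem laplacian_strainFlat {v : UnitAddTorus d → EuclideanSpace ℝ d} (hv : Torus.IsSmooth v)
    (x : UnitAddTorus d) :
    Torus.laplacian (strainFlat v) x = strainFlat (Torus.laplacian v) x := by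
  have hS := isSmooth_strainFlat hv
  ext p
  -- component `p` of the Laplacian of the flattened strain
  have hL : (Torus.laplacian (strainFlat v) x) p = Torus.laplacian (fun y => strainFlat v y p) x := by
    have h := Torus.laplacian_clm_comp_apply hS
      (EuclideanSpace.proj p : EuclideanSpace ℝ (d × d) →L[ℝ] ℝ) x
    have e : (⇑(EuclideanSpace.proj p : EuclideanSpace ℝ (d × d) →L[ℝ] ℝ) ∘ strainFlat v) =
        fun y => strainFlat v y p := by
      funext y; rfl
    rw [e] at h
    rw [h]
    rfl
  rw [hL]
  set a : UnitAddTorus d → ℝ := fun y => Torus.partialDeriv p.2 v y p.1 with ha_def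
  set b : UnitAddTorus d → ℝ := fun y => Torus.partialDeriv p.1 v y p.2 with hb_def
  have ha : Torus.IsSmooth a := (hv.partialDeriv p.2).apply p.1
  have hb : Torus.IsSmooth b := (hv.partialDeriv p.1).apply p.2
  have hfun : (fun y => strainFlat v y p) = (2 : ℝ)⁻¹ • (a + b) := by
    funext y
    simp only [strainFlat_apply, Pi.smul_apply, Pi.add_apply, smul_eq_mul, ha_def, hb_def]
    ring
  rw [hfun, Torus.laplacian_const_smul_apply (ha.add hb),
    Literature.Analysis.FunctionSpaces.Torus.laplacian_add_apply ha hb]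
  -- `Δ a = (Δ ∂_{p.2} v)_{p.1} = (∂_{p.2} Δ v)_{p.1}`, and the same for `b`
  have hca : Torus.laplacian a x = Torus.partialDeriv p.2 (Torus.laplacian v) x p.1 := by
    have h := Torus.laplacian_clm_comp_apply (hv.partialDeriv p.2)
      (EuclideanSpace.proj p.1 : EuclideanSpace ℝ d →L[ℝ] ℝ) x
    have e : (⇑(EuclideanSpace.proj p.1 : EuclideanSpace ℝ d →L[ℝ] ℝ) ∘ Torus.partialDeriv p.2 v) = a := by
      funext y; rfl
    rw [e] at h
    rw [h, Torus.partialDeriv_laplacian_comm hv p.2 x]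
    rfl
  have hcb : Torus.laplacian b x = Torus.partialDeriv p.1 (Torus.laplacian v) x p.2 := by
    have h := Torus.laplacian_clm_comp_apply (hv.partialDeriv p.1)
      (EuclideanSpace.proj p.2 : EuclideanSpace ℝ d →L[ℝ] ℝ) x
    have e : (⇑(EuclideanSpace.proj p.2 : EuclideanSpace ℝ d →L[ℝ] ℝ) ∘ Torus.partialDeriv p.1 v) = b := by
      funext y; rfl
    rw [e] at h
    rw [h, Torus.partialDeriv_laplacian_comm hv p.1 x]
    rfl
  rw [hca, hcb, strainFlat_apply, smul_eq_mul]
  ring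

/-! ## §3 Discrete integration by parts on the torus -/

omit [DecidableEq d] in
/-- **Discrete integration by parts.** For continuous `φ, f : T^d → ℝ` and any `a`:
`∫ φ(x) (f(x+a) + f(x−a) − 2f(x)) dx = −∫ (φ(x+a) − φ(x)) (f(x+a) − f(x)) dx`
(translation invariance of Haar measure). [ours] -/
theorem integral_mul_secondDiff_eq {φ f : UnitAddTorus d → ℝ} (hφ : Continuous φ) (hf : Continuous f)
    (a : UnitAddTorus d) :
    ∫ x, φ x * (f (x + a) + f (x - a) - 2 * f x) =
      -∫ x, (φ (x + a) - φ x) * (f (x + a) - f x) := by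
  have cfa : Continuous fun x => f (x + a) := hf.comp (continuous_id.add continuous_const)
  have cfm : Continuous fun x => f (x - a) := hf.comp (continuous_id.sub continuous_const)
  have cφa : Continuous fun x => φ (x + a) := hφ.comp (continuous_id.add continuous_const)
  have i1 : Integrable (fun x => φ x * f (x + a)) := (hφ.mul cfa).integrable_unitAddTorus
  have i2 : Integrable (fun x => φ x * f (x - a)) := (hφ.mul cfm).integrable_unitAddTorus
  have i3 : Integrable (fun x => φ x * f x) := (hφ.mul hf).integrable_unitAddTorus
  have i4 : Integrable (fun x => φ (x + a) * f (x + a)) := (cφa.mul cfa).integrable_unitAddTorus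
  have i5 : Integrable (fun x => φ (x + a) * f x) := (cφa.mul hf).integrable_unitAddTorus
  have t1 : ∫ x, φ (x + a) * f (x + a) = ∫ x, φ x * f x :=
    integral_add_right_eq_self (μ := volume) (fun y => φ y * f y) a
  have t2 : ∫ x, φ (x + a) * f x = ∫ x, φ x * f (x - a) := by
    have h := integral_add_right_eq_self (μ := volume) (fun y => φ y * f (y - a)) a
    simpa only [add_sub_cancel_right] using h
  have eL : (fun x => φ x * (f (x + a) + f (x - a) - 2 * f x)) =
      fun x => (φ x * f (x + a) + φ x * f (x - a)) - 2 * (φ x * f x) := by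
    funext x; ring
  have eR : (fun x => (φ (x + a) - φ x) * (f (x + a) - f x)) =
      fun x => (φ (x + a) * f (x + a) - φ (x + a) * f x) - (φ x * f (x + a) - φ x * f x) := by
    funext x; ring
  have i12 : Integrable (fun x => φ x * f (x + a) + φ x * f (x - a)) := i1.add i2
  have i33 : Integrable (fun x => 2 * (φ x * f x)) := i3.const_mul 2
  have i45 : Integrable (fun x => φ (x + a) * f (x + a) - φ (x + a) * f x) := i4.sub i5
  have i13 : Integrable (fun x => φ x * f (x + a) - φ x * f x) := i1.sub i3
  rw [eL, eR, integral_sub i12 i33, integral_add i1 i2, integral_const_mul,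
    integral_sub i45 i13, integral_sub i4 i5, integral_sub i1 i3, t1, t2]
  ring

/-! ## §4 The pointwise second-difference inequality for `λ₁ ∘ S` -/

omit [DecidableEq d] in
/-- `quad` of a finite sum of tensors. [ours, bookkeeping] (Renamed `quad_finset_sum_af` and `private`: the tree
declares `TopEig.quad_finset_sum` in `TopEigTransportSelection`; F14-1 of the no-go seat's READ 14 and census-1's
O-1 — a `private` decl may not shadow a public one visible in the same environment, so the rename is the robust fix.) -/
private theorem quad_finset_sum_af {ι : Type*} (s : Finset ι) (N : ι → EuclideanSpace ℝ (d × d)) (e : d → ℝ) :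
    quad (∑ k ∈ s, N k) e = ∑ k ∈ s, quad (N k) e := by
  classical
  refine Finset.induction_on s ?_ ?_
  · simp [quad]
  · intro k s hk ih
    rw [Finset.sum_insert hk, Finset.sum_insert hk, quad_add, ih]

section Pointwise

variable [Nonempty d]

/-- **Pointwise second-difference inequality (every `x`, every `t`).** For smooth `v` with
`S := S_v`, `λ := λ₁ ∘ S` and `μ(x) := μ(S(x); S_(Δv)(x))` (the Danskin directional value),
`t² μ(x) − C|t|³ ≤ Σᵢ [λ(x + teᵢ) + λ(x − teᵢ) − 2λ(x)]`:
for a top unit vector `e` of `S(x)`, `λ ≥ eᵀS(·)e` everywhere with equality at `x`, so the second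
differences of `λ` dominate those of the smooth scalar `eᵀS(·)e`, whose sum over the axes is
`t² eᵀ(ΔS)(x)e + O(|t|³)` uniformly (§1), and `ΔS = S_(Δv)` (§2). [ours] -/
theorem exists_topEig_secondDiff_ge {v : UnitAddTorus d → EuclideanSpace ℝ d}
    (hv : Torus.IsSmooth v) : ∃ C, ∀ (x : UnitAddTorus d) (t : ℝ),
      t ^ 2 * dirTopEig (strainFlat v x) (strainFlat (Torus.laplacian v) x) - C * |t| ^ 3 ≤
        ∑ i, (torusStrainTopEig v (x + Torus.proj (t • EuclideanSpace.single i (1 : ℝ))) +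
          torusStrainTopEig v (x + Torus.proj ((-t) • EuclideanSpace.single i (1 : ℝ))) -
          2 * torusStrainTopEig v x) := by
  have hS := isSmooth_strainFlat hv
  choose C hC using fun i : d =>
    exists_norm_secondDiff_sub_le (strainFlat v) hS (EuclideanSpace.single i (1 : ℝ))
  refine ⟨∑ i, C i, fun x t => ?_⟩
  -- the Laplacian of `S` as the sum of pure second derivatives, and `ΔS = S_(Δv)`
  have hlap : ∑ i, Torus.lineDeriv (fun y => Torus.lineDeriv (strainFlat v) y
      (EuclideanSpace.single i (1 : ℝ))) x (EuclideanSpace.single i (1 : ℝ)) =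
      strainFlat (Torus.laplacian v) x := by
    rw [← laplacian_strainFlat hv x, Torus.laplacian_eq_sum_partialDeriv_partialDeriv hS x]
    rfl
  -- the summed second differences of `S` are `t² S_(Δv)(x)` up to `C|t|³`
  have hnorm : ‖∑ i, (strainFlat v (x + Torus.proj (t • EuclideanSpace.single i (1 : ℝ))) +
      strainFlat v (x + Torus.proj ((-t) • EuclideanSpace.single i (1 : ℝ))) -
      (2 : ℝ) • strainFlat v x) - t ^ 2 • strainFlat (Torus.laplacian v) x‖ ≤ (∑ i, C i) * |t| ^ 3 := by
    rw [← hlap, Finset.smul_sum, ← Finset.sum_sub_distrib, Finset.sum_mul]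
    exact (norm_sum_le _ _).trans (Finset.sum_le_sum fun i _ => hC i x t)
  -- upper bound: test the summed second differences of `S` on a top vector of `S(x)`
  have hup : dirTopEig (strainFlat v x)
      (∑ i, (strainFlat v (x + Torus.proj (t • EuclideanSpace.single i (1 : ℝ))) +
        strainFlat v (x + Torus.proj ((-t) • EuclideanSpace.single i (1 : ℝ))) -
        (2 : ℝ) • strainFlat v x)) ≤
      ∑ i, (torusStrainTopEig v (x + Torus.proj (t • EuclideanSpace.single i (1 : ℝ))) +
        torusStrainTopEig v (x + Torus.proj ((-t) • EuclideanSpace.single i (1 : ℝ))) -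
        2 * torusStrainTopEig v x) := by
    refine dirTopEig_le fun e he => ?_
    rw [quad_finset_sum_af]
    refine Finset.sum_le_sum fun i _ => ?_
    rw [quad_sub, quad_add, quad_smul, he.2, ← lam_strainFlat v, ← lam_strainFlat v,
      ← lam_strainFlat v]
    have h1 := quad_le_lam (strainFlat v (x + Torus.proj (t • EuclideanSpace.single i (1 : ℝ)))) he.1
    have h2 := quad_le_lam (strainFlat v (x + Torus.proj ((-t) • EuclideanSpace.single i (1 : ℝ)))) he.1
    linarith
  -- lower bound: `μ` is subadditive and `1`-Lipschitz in the direction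
  have hlow : t ^ 2 * dirTopEig (strainFlat v x) (strainFlat (Torus.laplacian v) x) -
      (∑ i, C i) * |t| ^ 3 ≤ dirTopEig (strainFlat v x)
      (∑ i, (strainFlat v (x + Torus.proj (t • EuclideanSpace.single i (1 : ℝ))) +
        strainFlat v (x + Torus.proj ((-t) • EuclideanSpace.single i (1 : ℝ))) -
        (2 : ℝ) • strainFlat v x)) := by
    set M := ∑ i, (strainFlat v (x + Torus.proj (t • EuclideanSpace.single i (1 : ℝ))) +
        strainFlat v (x + Torus.proj ((-t) • EuclideanSpace.single i (1 : ℝ))) -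
        (2 : ℝ) • strainFlat v x) with hM
    have h1 := dirTopEig_add_le (strainFlat v x) M (t ^ 2 • strainFlat (Torus.laplacian v) x - M)
    rw [add_sub_cancel, dirTopEig_smul_of_nonneg (sq_nonneg t)] at h1
    have h2 := dirTopEig_le_norm (strainFlat v x) (t ^ 2 • strainFlat (Torus.laplacian v) x - M)
    rw [norm_sub_rev] at h2
    linarith [hnorm]
  exact hlow.trans hup

end Pointwise

end TopEig

end Summit.NavierStokesRegularity.FunctionalMining

end
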